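import Summits.QuantumFields.YangMills.Theorems.ThermalDescentMaxwellRungDefs

/-!
# `ThermalDescent` / `ZeroTemperatureFloors` BC5 rung — file 2/6: kernel algebra of the free Maxwell₄ covariance

Tribunal-w seat `ym-td-bc5w-1` (planner, gen 2).  The six files `ThermalDescentMaxwellRung{Defs,Kernel,Images,Window,
Chain,Floors}` are the ≤ 400-line Theorems split of the crux workfile
`Cruxes/ZeroTemperatureFloors/Lines/rung_maxwell.lean` (commit 53ced2b6fc84): the thermal free Maxwell₄ field as a
DECIDED SEPARATING MODEL for the deciding crux `ZeroTemperatureFloors` (stmt-QuantumFields-25390) of route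
`ThermalDescent` — statement, dictionary and mechanism in `…Floors`.  Helper files (`--supports` the crux), close nothing;
route-independent (imports `Mathlib`, the Mathlib-only certificate `TreeLevelSkewnessVanishes`, `Literature…EuclideanAction`).

`tr K(h)K(g) = 2 tr(hg) + tr h tr g` on `Λ²ℝ⁴` (`trace_K_mul_K`), the closed form
`tr (∂∂|a|⁻²)(∂∂|b|⁻²) = (64(a·b)² − 16|a|²|b|²)/(|a|⁶|b|⁶)` (`trace_hessInvSq_mul`), its non-negativity on the double cone
`4|a⃗|² ≤ a₀²` (`cone_criterion`, `trace_hessInvSq_mul_nonneg`), the entry bound `|(∂∂|a|⁻²)_{μρ}| ≤ 10/|a|⁴` (`abs_hessInvSq_le`),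
symmetry and tracelessness of the Hessian (`hessInvSq_isSymm`, `hessInvSq_trace`).

NOTHING HERE PROVES `ZeroTemperatureFloors`, `NT`, or the Yang–Mills mass gap: free-field Gaussian analysis on `ℝ⁴`,
a witness (R3/RECORD framing) that the deciding crux has content of its own outside NT's printed regime.
[cite: OsterwalderSeilerAnnPhys1978, §2–3; Luscher1977; GlimmJaffe1987, §6.3, §7]
-/

set_option autoImplicit false

open scoped SchwartzMap BigOperators Topology
open MeasureTheory Filter Topology Matrix Metric Set
open Literature.MathematicalPhysics.QuantumLattice

noncomputable section

namespace Summit.QuantumFields.YangMills.Theorems.ThermalDescent.MaxwellRung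
open Summit.QuantumFields.YangMills.Theorems.SelfNormalisedSkewness.Negative

/-! ## §0 The free Maxwell₄ field-strength covariance (route-independent restatement)

These are verbatim the definitions `E4`, `nsq`, `hessInvSq`, `maxwellKernel`, `e₀` of
`Theorems/SelfNormalisedSkewness/Negative/SelfNormalisedSkewnessFalseOfMaxwellDominatedWindowScheme`
(the model that refuted `SelfNormalisedSkewness` and carries FRM's BC5 witness), restated here over the
Mathlib-only certificate file `TreeLevelSkewnessVanishes` (`K`, `p1`, `p2`, `δ`,
`treeLevelSkewness_vanishes`) so that this witness does not sit in any route's rebuild cone. -/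

/-- The Hessian is symmetric. [folklore] -/
theorem hessInvSq_isSymm (x : E4) : (hessInvSq x).IsSymm :=
  Matrix.IsSymm.ext fun i j => by
    unfold hessInvSq δ
    by_cases hij : i = j
    · subst hij; rfl
    · rw [if_neg hij, if_neg (Ne.symm hij)]; ring

/-- The Hessian is traceless (`|x|⁻²` is harmonic in `d = 4`; junk `0` at the origin). [folklore] -/
theorem hessInvSq_trace (x : E4) : (hessInvSq x).trace = 0 := by
  have hsum : ∑ μ : Fin 4, 8 * x μ * x μ / nsq x ^ 3 = 8 * nsq x / nsq x ^ 3 := by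
    rw [← Finset.sum_div, nsq, Finset.mul_sum]
    congr 1
    exact Finset.sum_congr rfl fun μ _ => by ring
  simp only [Matrix.trace, Matrix.diag, hessInvSq, δ, if_true, Finset.sum_sub_distrib, hsum,
    Finset.sum_const, Finset.card_univ, Fintype.card_fin, nsmul_eq_mul]
  by_cases h0 : nsq x = 0
  · simp [h0]
  · field_simp
    ring

/-! ## §A Kernel algebra: two-matrix traces, the cross-image closed form, the cone criterion -/

/-- `tr K(h)K(g) = 2 tr(hg) + tr h · tr g` for symmetric `h, g` (the derivation action on `Λ²ℝ⁴`).
[folklore] -/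
theorem trace_K_mul_K (h g : Matrix (Fin 4) (Fin 4) ℝ) (h10 : h 1 0 = h 0 1) (h20 : h 2 0 = h 0 2)
    (h30 : h 3 0 = h 0 3) (h21 : h 2 1 = h 1 2) (h31 : h 3 1 = h 1 3) (h32 : h 3 2 = h 2 3)
    (g10 : g 1 0 = g 0 1) (g20 : g 2 0 = g 0 2) (g30 : g 3 0 = g 0 3) (g21 : g 2 1 = g 1 2)
    (g31 : g 3 1 = g 1 3) (g32 : g 3 2 = g 2 3) :
    (K h * K g).trace = 2 * (h * g).trace + h.trace * g.trace := by
  simp +decide [Matrix.trace, Matrix.mul_apply, Fin.sum_univ_succ, K, p1, p2, δ, h10, h20, h30, h21,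
    h31, h32, g10, g20, g30, g21, g31, g32]
  ring

/-- Symmetric-matrix version. [folklore] -/
theorem trace_K_mul_K_of_isSymm {h g : Matrix (Fin 4) (Fin 4) ℝ} (hh : h.IsSymm) (hg : g.IsSymm) :
    (K h * K g).trace = 2 * (h * g).trace + h.trace * g.trace :=
  trace_K_mul_K h g (hh.apply 0 1) (hh.apply 0 2) (hh.apply 0 3) (hh.apply 1 2) (hh.apply 1 3)
    (hh.apply 2 3) (hg.apply 0 1) (hg.apply 0 2) (hg.apply 0 3) (hg.apply 1 2) (hg.apply 1 3)
    (hg.apply 2 3)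

/-- `hessInvSq` is even. [folklore] -/
theorem hessInvSq_neg (x : E4) : hessInvSq (-x) = hessInvSq x := by
  ext μ ρ
  simp [hessInvSq, nsq]

/-- `maxwellKernel` is even. [folklore] -/
theorem maxwellKernel_neg (x : E4) : maxwellKernel (-x) = maxwellKernel x := by
  rw [maxwellKernel, maxwellKernel, hessInvSq_neg]

/-- `nsq z = ‖z‖²`. [folklore] -/
theorem nsq_eq_norm_sq (z : E4) : nsq z = ‖z‖ ^ 2 := by
  rw [EuclideanSpace.real_norm_sq_eq]; rfl

/-- `0 ≤ nsq z`. [folklore] -/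
theorem nsq_nonneg (z : E4) : 0 ≤ nsq z := by
  rw [nsq_eq_norm_sq]; positivity

/-- A coordinate is bounded by the Euclidean norm. [folklore] -/
theorem abs_apply_le_norm (z : E4) (i : Fin 4) : |z i| ≤ ‖z‖ := by
  simpa [Real.norm_eq_abs] using PiLp.norm_apply_le z i

/-- `|a|² = a₀² + |a⃗|²`. [folklore] -/
theorem nsq_eq_time_add_spSq (a : E4) : nsq a = a 0 ^ 2 + spSq a := by
  simp only [nsq, spSq, Fin.sum_univ_four]
  ring

/-- `0 ≤ |a⃗|²`. [folklore] -/
theorem spSq_nonneg (a : E4) : 0 ≤ spSq a := by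
  unfold spSq; positivity

/-- **The cross-image closed form**: `tr (∂∂|a|⁻²)(∂∂|b|⁻²) = (64(a·b)² − 16|a|²|b|²)/(|a|⁶|b|⁶)`
(junk-consistent at `a = 0` or `b = 0`). [folklore] -/
theorem trace_hessInvSq_mul (a b : E4) :
    (hessInvSq a * hessInvSq b).trace =
      (64 * ip a b ^ 2 - 16 * (nsq a * nsq b)) / (nsq a ^ 3 * nsq b ^ 3) := by
  by_cases ha : nsq a = 0
  · have hz : hessInvSq a = 0 := by
      ext μ ρ; simp [hessInvSq, ha]
    simp [hz, ha]
  by_cases hb : nsq b = 0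
  · have hz : hessInvSq b = 0 := by
      ext μ ρ; simp [hessInvSq, hb]
    simp [hz, hb]
  have hna : nsq a = a 0 ^ 2 + a 1 ^ 2 + a 2 ^ 2 + a 3 ^ 2 := by
    simp [nsq, Fin.sum_univ_four]
  have hnb : nsq b = b 0 ^ 2 + b 1 ^ 2 + b 2 ^ 2 + b 3 ^ 2 := by
    simp [nsq, Fin.sum_univ_four]
  have hip : ip a b = a 0 * b 0 + a 1 * b 1 + a 2 * b 2 + a 3 * b 3 := by
    simp [ip, Fin.sum_univ_four]
  simp only [Matrix.trace, Matrix.diag, Matrix.mul_apply, Fin.sum_univ_four, hessInvSq, δ]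
  simp +decide only [Fin.isValue, if_true, if_false]
  rw [hip]
  field_simp
  rw [hna, hnb]
  ring

/-- The diagonal case: `tr (∂∂|x|⁻²)² = 48/|x|⁸`. [folklore] -/
theorem trace_hessInvSq_sq (x : E4) : (hessInvSq x * hessInvSq x).trace = 48 / nsq x ^ 4 := by
  by_cases h0 : nsq x = 0
  · have hz : hessInvSq x = 0 := by
      ext μ ρ; simp [hessInvSq, h0]
    simp [hz, h0]
  · have hn : nsq x = x 0 ^ 2 + x 1 ^ 2 + x 2 ^ 2 + x 3 ^ 2 := by
      simp [nsq, Fin.sum_univ_four]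
    simp only [Matrix.trace, Matrix.diag, Matrix.mul_apply, Fin.sum_univ_four, hessInvSq, δ]
    simp +decide only [Fin.isValue, if_true, if_false]
    field_simp
    rw [hn]
    ring

/-- **The cone criterion**: if both separations lie in the double cone `4·(spatial)² ≤ (time)²`
around the time axis, then `|a|²|b|² ≤ 4(a·b)²` (the angle between `a` and `±b` is at most `60°`).
[folklore] -/
theorem cone_criterion {a b : E4} (ha : 4 * spSq a ≤ a 0 ^ 2) (hb : 4 * spSq b ≤ b 0 ^ 2) :
    nsq a * nsq b ≤ 4 * ip a b ^ 2 := by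
  have hip : ip a b = a 0 * b 0 + (a 1 * b 1 + a 2 * b 2 + a 3 * b 3) := by
    simp [ip, Fin.sum_univ_four]; ring
  have hCS : (a 1 * b 1 + a 2 * b 2 + a 3 * b 3) ^ 2 ≤ spSq a * spSq b := by
    unfold spSq
    nlinarith [sq_nonneg (a 1 * b 2 - a 2 * b 1), sq_nonneg (a 1 * b 3 - a 3 * b 1),
      sq_nonneg (a 2 * b 3 - a 3 * b 2)]
  have hSA := spSq_nonneg a
  have hSB := spSq_nonneg b
  have hSS : spSq a * spSq b ≤ (a 0 ^ 2 / 4) * (b 0 ^ 2 / 4) :=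
    mul_le_mul (by linarith) (by linarith) hSB (by positivity)
  have h16 : 16 * (a 1 * b 1 + a 2 * b 2 + a 3 * b 3) ^ 2 ≤ a 0 ^ 2 * b 0 ^ 2 := by
    nlinarith
  have hL : nsq a * nsq b ≤ (5 / 4 * a 0 ^ 2) * (5 / 4 * b 0 ^ 2) := by
    rw [nsq_eq_time_add_spSq, nsq_eq_time_add_spSq]
    exact mul_le_mul (by linarith) (by linarith) (by positivity) (by positivity)
  rw [hip]
  nlinarith [sq_nonneg (a 0 * b 0 + 4 * (a 1 * b 1 + a 2 * b 2 + a 3 * b 3)), h16, hL,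
    sq_nonneg (a 0 * b 0), sq_nonneg (a 1 * b 1 + a 2 * b 2 + a 3 * b 3)]

/-- Under the cone criterion the cross-image trace is non-negative. [folklore] -/
theorem trace_hessInvSq_mul_nonneg {a b : E4} (h : nsq a * nsq b ≤ 4 * ip a b ^ 2) :
    0 ≤ (hessInvSq a * hessInvSq b).trace := by
  rw [trace_hessInvSq_mul]
  apply div_nonneg
  · linarith
  · have := nsq_nonneg a; have := nsq_nonneg b; positivity

/-- Entry bound `|(∂∂|a|⁻²)_{μρ}| ≤ 10/|a|⁴` (junk-consistent at `a = 0`). [folklore] -/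
theorem abs_hessInvSq_le (a : E4) (μ ρ : Fin 4) : |hessInvSq a μ ρ| ≤ 10 / nsq a ^ 2 := by
  by_cases h0 : nsq a = 0
  · simp [hessInvSq, h0]
  have hpos : 0 < nsq a := lt_of_le_of_ne (nsq_nonneg a) (Ne.symm h0)
  have hprod : |a μ * a ρ| ≤ nsq a := by
    rw [abs_mul, nsq_eq_norm_sq, sq]
    exact mul_le_mul (abs_apply_le_norm a μ) (abs_apply_le_norm a ρ) (abs_nonneg _) (norm_nonneg _)
  have hδ : |δ μ ρ| ≤ 1 := by
    unfold δ; split_ifs <;> simp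
  have h1 : |8 * a μ * a ρ / nsq a ^ 3| ≤ 8 / nsq a ^ 2 := by
    rw [abs_div, abs_of_pos (pow_pos hpos 3), mul_assoc, abs_mul, abs_of_pos (by norm_num : (0:ℝ) < 8),
      div_le_div_iff₀ (pow_pos hpos 3) (pow_pos hpos 2)]
    nlinarith [pow_pos hpos 2, pow_pos hpos 4]
  have h2 : |2 * δ μ ρ / nsq a ^ 2| ≤ 2 / nsq a ^ 2 := by
    rw [abs_div, abs_of_pos (pow_pos hpos 2), abs_mul, abs_of_pos (by norm_num : (0:ℝ) < 2)]
    apply div_le_div_of_nonneg_right _ (pow_pos hpos 2).le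
    nlinarith
  unfold hessInvSq
  calc |8 * a μ * a ρ / nsq a ^ 3 - 2 * δ μ ρ / nsq a ^ 2|
      ≤ |8 * a μ * a ρ / nsq a ^ 3| + |2 * δ μ ρ / nsq a ^ 2| := abs_sub _ _
    _ ≤ 8 / nsq a ^ 2 + 2 / nsq a ^ 2 := add_le_add h1 h2
    _ = 10 / nsq a ^ 2 := by ring

end Summit.QuantumFields.YangMills.Theorems.ThermalDescent.MaxwellRung

end
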